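import Mathlib.GroupTheory.Perm.Fin
import Literature.NumberTheory.Transcendental.KZProductIdeal
import Literature.NumberTheory.Transcendental.KZMellinFibres
import Summits.KontsevichZagierPeriods.KontsevichZagierPeriods.Theses.HeckeMultiplicityOne

/-!
# `DeltaFunctionalEquation` (stmt-KontsevichZagierPeriods-4693, route `HeckeMultiplicityOne`, support #9)

The calibration identity `R₃ ~ R₉` of the route's Legendre-family representations of
`2⁸π¹¹ L*(Δ, s)` on the open cube `(0,1)¹¹` (Kontsevich–Zagier 2001, §3.4; the functional equation
`L*(Δ, s) = L*(Δ, 12 − s)`, i.e. the Fricke involution `λ ↦ 1 − λ` on the Legendre line):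
for any two KZ representations `r₃`, `r₉` in dimension `11` whose domain is the open unit cube and
whose integrands agree there with
`t(1−t) · ∏_{i<10} (x_{i+1}(1−x_{i+1})(1 − c_i x_{i+1}))^{-1/2}`, `c_i = t` for `i < 8` (resp. `i < 2`)
and `c_i = 1 − t` otherwise, `[r₃] − [r₉] ∈ KZ.relations`.

Proof (two instances of rule (2), both already in the tree):
* the coordinate permutation `e` of `Fin 11` fixing `0` and acting on the ten `x`-slots by the
  shift `i ↦ i + 2 (mod 10)` is a move, `[r₃] − [r₃.reindex e] ∈ relations`
  (`KZ.of_sub_of_reindex_mem_relations`, `KZProductIdeal`);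
* the box reflection `t ↦ 1 − t` of the `0`-th coordinate is a move
  (`KZ.of_sub_of_mem_relations_of_boxReflection`, `KZMellinFibres`); it carries the integrand of
  `r₃.reindex e` to that of `r₉` on the nose (reindex the product over `Fin 10` along the shift).
No new definitions, no named facts.

Sources: M. Kontsevich, D. Zagier, *Periods* (2001), §1.2 rule (2), §3.4; Yu. I. Manin, *Periods of
parabolic forms and p-adic Hecke series* (1973) (the functional equation of `L(Δ, s)`).
-/

namespace Summit.KontsevichZagierPeriods.HeckeMultiplicityOne

open Literature.NumberTheory.Transcendental

/-- **`DeltaFunctionalEquation` holds** (route `HeckeMultiplicityOne`, item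
stmt-KontsevichZagierPeriods-4693): the Legendre representations `R₃` and `R₉` of
`2⁸π¹¹L*(Δ,3) = 2⁸π¹¹L*(Δ,9)` on `(0,1)¹¹` are KZ-equivalent, by the single change of variables
`(t, x, y) ↦ (1 − t, y, x)` factored as a coordinate permutation followed by the box reflection
`t ↦ 1 − t`. [Kontsevich–Zagier 2001, §1.2 rule (2), §3.4] [folklore] -/
theorem deltaFunctionalEquation_proof :
    Summit.KontsevichZagierPeriods.KontsevichZagierPeriods.Theses.HeckeMultiplicityOne.DeltaFunctionalEquation := by
  unfold Summit.KontsevichZagierPeriods.KontsevichZagierPeriods.Theses.HeckeMultiplicityOne.DeltaFunctionalEquation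
  intro r₃ r₉ hd₃ hi₃ hd₉ hi₉
  -- the shift `i ↦ i + 2` of the ten `x`-slots: slots `8, 9` (factor `1 − t`) go to `0, 1`
  obtain ⟨π, hπ⟩ : ∃ π : Equiv.Perm (Fin 10), ∀ i : Fin 10, ((π i : ℕ) < 2 ↔ ¬ ((i : ℕ) < 8)) :=
    ⟨Equiv.addRight (2 : Fin 10), by decide⟩
  -- its extension to `Fin 11` fixing the `t`-slot `0`
  obtain ⟨e, he0, hes⟩ : ∃ e : Equiv.Perm (Fin 11), e 0 = 0 ∧ ∀ i : Fin 10, e i.succ = (π i).succ :=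
    ⟨Equiv.Perm.decomposeFin.symm (0, π), Equiv.Perm.decomposeFin_symm_apply_zero 0 π, fun i => by
      rw [Equiv.Perm.decomposeFin_symm_apply_succ, Equiv.swap_self, Equiv.refl_apply]⟩
  -- move 1: the coordinate permutation
  have h₁ : KZ.of r₃ - KZ.of (r₃.reindex e) ∈ KZ.relations := KZ.of_sub_of_reindex_mem_relations r₃ e
  -- move 2: the box reflection `t ↦ 1 − t`
  have h₂ : KZ.of (r₃.reindex e) - KZ.of r₉ ∈ KZ.relations := by
    refine KZ.of_sub_of_mem_relations_of_boxReflection (0 : Fin 11) ?_ ?_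
    · -- domains: both are the open unit cube, which `e` and the reflection preserve
      rw [KZ.IntegralRep.reindex_domain, hd₃, hd₉]
      ext w
      simp only [Set.mem_setOf_eq, Set.mem_preimage, KZ.forall_boxReflection_mem_Ioo_iff]
      exact e.forall_congr_right (q := fun j => w j ∈ Set.Ioo (0:ℝ) 1)
    · -- integrands
      intro x hx
      have hxe : (fun i => x (e i)) ∈ r₃.domain := hx
      have hx' : ∀ j, x j ∈ Set.Ioo (0:ℝ) 1 := by
        have h : ∀ i, x (e i) ∈ Set.Ioo (0:ℝ) 1 := by
          simpa only [KZ.IntegralRep.reindex_domain, hd₃, Set.mem_setOf_eq] using hx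
        exact (e.forall_congr_right (q := fun j => x j ∈ Set.Ioo (0:ℝ) 1)).mp h
      have hxr : KZ.boxReflection 0 x ∈ r₉.domain := by
        rw [hd₉]
        exact KZ.forall_boxReflection_mem_Ioo_iff.mpr hx'
      have hprod :
          (∏ i : Fin 10, 1 / Real.sqrt (x (π i).succ * (1 - x (π i).succ) *
              (1 - (if (i : ℕ) < 8 then x 0 else 1 - x 0) * x (π i).succ))) =
            ∏ i : Fin 10, 1 / Real.sqrt (x i.succ * (1 - x i.succ) *
              (1 - (if (i : ℕ) < 2 then 1 - x 0 else x 0) * x i.succ)) := by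
        rw [← Equiv.prod_comp π (fun i : Fin 10 => 1 / Real.sqrt (x i.succ * (1 - x i.succ) *
              (1 - (if (i : ℕ) < 2 then 1 - x 0 else x 0) * x i.succ)))]
        refine Finset.prod_congr rfl fun i _ => ?_
        by_cases h8 : (i : ℕ) < 8
        · have h2 : ¬ ((π i : ℕ) < 2) := fun h => (hπ i).mp h h8
          simp only [if_pos h8, if_neg h2]
        · have h2 : (π i : ℕ) < 2 := (hπ i).mpr h8
          simp only [if_neg h8, if_pos h2]
      change r₃.integrand (fun i => x (e i)) = r₉.integrand (KZ.boxReflection 0 x)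
      rw [hi₃ hxe, hi₉ hxr]
      simp only [he0, hes, KZ.boxReflection_apply_self, KZ.boxReflection_apply_of_ne, ne_eq,
        Fin.succ_ne_zero, not_false_eq_true, sub_sub_cancel]
      rw [hprod]
      ring
  -- glue
  have h := KZ.relations.add_mem h₁ h₂
  rwa [sub_add_sub_cancel] at h

end Summit.KontsevichZagierPeriods.HeckeMultiplicityOne
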